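import Literature.Algebra.Homology.InfiniteCyclicQuotientCohomology
import HarnessLib

/-!
# `Hⁿ(G, A)` for `G` free abelian of rank `2`: finitely generated, and zero for `n ≥ 3`

Topic `Algebra/Homology`; namespace `Literature.Algebra.Homology`.  Mathlib + the sibling
`InfiniteCyclicQuotientCohomology` only.

For a group `G` which is free abelian of rank two — given by two commuting elements `b₁, b₂`
such that every element is `b₁^{m₁} b₂^{m₂}` for a unique pair `(m₁, m₂)` — and a representation
`A` of `G` finitely generated over a Noetherian ring `k`:

* `moduleFinite_groupCohomology_of_rankTwo` — `Hⁿ(G, A)` is finitely generated over `k` for all `n`;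
* `isZero_groupCohomology_of_rankTwo` — `Hⁿ(G, A) = 0` for `n ≥ 3`.

Both are the case `G ⊵ ⟨b₁⟩ ⊵ 1` of the two-step dévissage of `InfiniteCyclicQuotientCohomology`
(`moduleFinite_groupCohomology_of_two_step`, `isZero_groupCohomology_add_three_of_two_step`),
i.e. the Wang sequences of the two infinite cyclic layers [Brown1982CohomologyGroups, VIII §2,
III §1 Ex. 1].  Use: the unipotent arithmetic groups `Γ ∩ N(F) ≅ 𝔞 ≅ ℤ²` of a Bianchi group.

## References

* K. S. Brown, *Cohomology of Groups*, GTM 87 (1982), III §1 Example 1, VIII §2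
  [Brown1982CohomologyGroups].
-/

noncomputable section

open CategoryTheory CategoryTheory.Limits

universe u

namespace Literature.Algebra.Homology

variable {k G : Type u} [CommRing k] [Group G] (A : Rep.{u} k G) (b₁ b₂ : G)
  (hcomm : ∀ a b : G, a * b = b * a)
  (hgen : ∀ g : G, ∃ m₁ m₂ : ℤ, g = b₁ ^ m₁ * b₂ ^ m₂)
  (hind : ∀ m₁ m₂ : ℤ, b₁ ^ m₁ * b₂ ^ m₂ = 1 → m₁ = 0 ∧ m₂ = 0)

include hcomm in
/-- In a commutative group every subgroup is normal. [folklore] -/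
theorem normal_of_comm (H : Subgroup G) : H.Normal :=
  ⟨fun a ha g => by rwa [hcomm g a, mul_inv_cancel_right]⟩

include hgen in
/-- Every element is `h t^n` with `h ∈ ⟨b₁⟩`, `t = b₂`. [folklore] -/
theorem exists_zpowers_mul_zpow (g : G) :
    ∃ (h : Subgroup.zpowers b₁) (n : ℤ), g = (h : G) * b₂ ^ n := by
  obtain ⟨m₁, m₂, rfl⟩ := hgen g
  exact ⟨⟨b₁ ^ m₁, Subgroup.zpow_mem_zpowers b₁ m₁⟩, m₂, rfl⟩

include hind in
/-- `b₂^n ∈ ⟨b₁⟩` forces `n = 0`. [folklore] -/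
theorem eq_zero_of_zpow_mem_zpowers (n : ℤ) (hn : b₂ ^ n ∈ Subgroup.zpowers b₁) : n = 0 := by
  obtain ⟨m, hm⟩ := Subgroup.mem_zpowers_iff.1 hn
  have h : b₁ ^ m * b₂ ^ (-n) = 1 := by
    change b₁ ^ m = b₂ ^ n at hm
    rw [hm, ← zpow_add, add_neg_cancel, zpow_zero]
  have := (hind m (-n) h).2
  omega

/-- `⟨b₁⟩` is cyclic on `b₁`. [folklore] -/
theorem exists_eq_zpow_of_mem_zpowers (h : Subgroup.zpowers b₁) :
    ∃ n : ℤ, h = (⟨b₁, Subgroup.mem_zpowers b₁⟩ : Subgroup.zpowers b₁) ^ n := by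
  obtain ⟨n, hn⟩ := Subgroup.mem_zpowers_iff.1 h.2
  exact ⟨n, Subtype.ext (by rw [SubgroupClass.coe_zpow]; exact hn.symm)⟩

include hind in
/-- `b₁^n = 1` forces `n = 0`. [folklore] -/
theorem eq_zero_of_zpow_eq_one (n : ℤ)
    (hn : (⟨b₁, Subgroup.mem_zpowers b₁⟩ : Subgroup.zpowers b₁) ^ n = 1) : n = 0 := by
  have h : b₁ ^ n * b₂ ^ (0 : ℤ) = 1 := by
    rw [zpow_zero, mul_one]
    have := congrArg Subtype.val hn
    rwa [SubgroupClass.coe_zpow] at this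
  exact (hind n 0 h).1

include hcomm hgen hind in
/-- **`Hⁿ(G, A)` is finitely generated** for `G` free abelian of rank `2` and `A` finitely
generated over a Noetherian `k`. [cite: Brown1982CohomologyGroups, VIII §2] -/
theorem moduleFinite_groupCohomology_of_rankTwo [IsNoetherianRing k] [Module.Finite k A] (n : ℕ) :
    Module.Finite k (groupCohomology A n) := by
  haveI := normal_of_comm hcomm (Subgroup.zpowers b₁)
  exact moduleFinite_groupCohomology_of_two_step (Subgroup.zpowers b₁) A b₂
    (exists_zpowers_mul_zpow b₁ b₂ hgen) (eq_zero_of_zpow_mem_zpowers b₁ b₂ hind)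
    ⟨b₁, Subgroup.mem_zpowers b₁⟩ (exists_eq_zpow_of_mem_zpowers b₁)
    (eq_zero_of_zpow_eq_one b₁ b₂ hind) n

include hcomm hgen hind in
/-- **`Hⁿ(G, A) = 0` for `n ≥ 3`** and `G` free abelian of rank `2` (`cd ℤ² = 2`).
[cite: Brown1982CohomologyGroups, VIII §2] -/
theorem isZero_groupCohomology_of_rankTwo (n : ℕ) : IsZero (groupCohomology A (n + 3)) := by
  haveI := normal_of_comm hcomm (Subgroup.zpowers b₁)
  exact isZero_groupCohomology_add_three_of_two_step (Subgroup.zpowers b₁) A b₂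
    (exists_zpowers_mul_zpow b₁ b₂ hgen) (eq_zero_of_zpow_mem_zpowers b₁ b₂ hind)
    ⟨b₁, Subgroup.mem_zpowers b₁⟩ (exists_eq_zpow_of_mem_zpowers b₁)
    (eq_zero_of_zpow_eq_one b₁ b₂ hind) n

end Literature.Algebra.Homology
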